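import Summits.Ventures.PercRepro.Transport
import Summits.Ventures.PercRepro.Injective

/-!
# PercRepro — simple graphs on `Fin n` are adjacency-matrix graphs: the census transfer (c4) (typer-2, gen 4)

`graphOf A` is the multigraph on `Fin n` whose edges are the pairs `i < j` with `A i j = true`. A
SIMPLE marked graph on at most `n` vertices is, up to an injective renaming of its vertices
(`mapVertices`), a bijective re-indexing of its edges (`mapEdges`) and the orientation of its edges
(`SameEnds`), the graph `graphOf A` of its own adjacency matrix (`adjOf`): `toPair` sends an edge
to its ordered endpoint pair, injective because the graph is simple and surjective by the
definition of `A`. Hence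

* **`cubeSumC011_eq_graphOf_adjOf`** — the C-011 class sum of a simple graph on `Fin n` is that of
  `graphOf (adjOf G)`;
* **`LemmaBPlusSimpleInjUpTo_of_graphOf`** — the census «`0 ≤ CS(graphOf A, m)` for every
  `A : Fin n → Fin n → Bool` and every injective marking» gives `LemmaBPlusSimpleInjUpTo n`, hence
  (`C005UpTo_of_simpleInj`) C-005 and C-011 on every multigraph with `≤ n` vertices at every `p`;
* `cubeSumC011_graphOf_congr` — `graphOf` only reads the upper triangle, so the census over the
  `2^(n(n−1)/2)` upper triangles suffices (the generator of the (d) spec).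
-/

namespace PercRepro

open Finset

namespace MultiGraph

/-! ### The graph of an adjacency matrix -/

/-- The edge type of the adjacency matrix `A`: the pairs `i < j` with `A i j = true`. -/
abbrev EdgesOf {n : ℕ} (A : Fin n → Fin n → Bool) : Type :=
  {ij : Fin n × Fin n // ij.1 < ij.2 ∧ A ij.1 ij.2 = true}

/-- The multigraph of an adjacency matrix (a simple graph: no loops, no parallel edges). -/
def graphOf {n : ℕ} (A : Fin n → Fin n → Bool) : MultiGraph (Fin n) (EdgesOf A) where
  fst ij := ij.1.1
  snd ij := ij.1.2

/-- `graphOf A` only depends on the upper triangle of `A`. -/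
theorem cubeSumC011_graphOf_congr {n : ℕ} {A A' : Fin n → Fin n → Bool}
    (h : ∀ i j : Fin n, i < j → A i j = A' i j) (m : Fin 4 → Fin n) :
    (graphOf A').cubeSumC011 m = (graphOf A).cubeSumC011 m := by
  have hp : ∀ ij : Fin n × Fin n, (ij.1 < ij.2 ∧ A ij.1 ij.2 = true) ↔
      (ij.1 < ij.2 ∧ A' ij.1 ij.2 = true) := fun ij => by
    constructor
    · rintro ⟨h1, h2⟩
      exact ⟨h1, by rw [← h _ _ h1]; exact h2⟩
    · rintro ⟨h1, h2⟩
      exact ⟨h1, by rw [h _ _ h1]; exact h2⟩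
  rw [← (graphOf A).cubeSumC011_mapEdges (Equiv.subtypeEquivRight hp) m]
  refine cubeSumC011_eq_of_sameEnds (fun ij => Or.inl ⟨?_, ?_⟩) m
  · rfl
  · rfl

/-! ### A simple graph on `Fin n` is the graph of its adjacency matrix -/

variable {n E : Type*}

/-- The adjacency matrix of a multigraph on `Fin n`. -/
def adjOf {n : ℕ} {E : Type*} [Fintype E] (G : MultiGraph (Fin n) E) : Fin n → Fin n → Bool :=
  fun i j => decide (∃ e, (G.fst e = i ∧ G.snd e = j) ∨ (G.fst e = j ∧ G.snd e = i))

/-- The ordered endpoint pair of an edge of a simple graph on `Fin n`, as an edge of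
`graphOf (adjOf G)`. -/
def toPair {n : ℕ} {E : Type*} [Fintype E] (G : MultiGraph (Fin n) E) (hs : G.IsSimple) (e : E) :
    EdgesOf (adjOf G) :=
  ⟨(min (G.fst e) (G.snd e), max (G.fst e) (G.snd e)), by
    have hne := hs.1 e
    constructor
    · exact min_lt_max.mpr hne
    · unfold adjOf
      rw [decide_eq_true_eq]
      rcases le_total (G.fst e) (G.snd e) with hle | hle
      · exact ⟨e, Or.inl ⟨(min_eq_left hle).symm, (max_eq_right hle).symm⟩⟩
      · exact ⟨e, Or.inr ⟨(max_eq_left hle).symm, (min_eq_right hle).symm⟩⟩⟩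

/-- `toPair` is injective: two edges with the same endpoint pair are parallel, hence equal. -/
theorem toPair_injective {n : ℕ} {E : Type*} [Fintype E] (G : MultiGraph (Fin n) E)
    (hs : G.IsSimple) : Function.Injective (G.toPair hs) := by
  intro e e' h
  have h1 := congrArg (fun x : EdgesOf (adjOf G) => x.1.1) h
  have h2 := congrArg (fun x : EdgesOf (adjOf G) => x.1.2) h
  simp only [toPair] at h1 h2
  apply hs.2
  rcases le_total (G.fst e) (G.snd e) with hle | hle <;>
    rcases le_total (G.fst e') (G.snd e') with hle' | hle'
  · rw [min_eq_left hle, min_eq_left hle'] at h1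
    rw [max_eq_right hle, max_eq_right hle'] at h2
    exact Or.inl ⟨h1, h2⟩
  · rw [min_eq_left hle, min_eq_right hle'] at h1
    rw [max_eq_right hle, max_eq_left hle'] at h2
    exact Or.inr ⟨h1, h2⟩
  · rw [min_eq_right hle, min_eq_left hle'] at h1
    rw [max_eq_left hle, max_eq_right hle'] at h2
    exact Or.inr ⟨h2, h1⟩
  · rw [min_eq_right hle, min_eq_right hle'] at h1
    rw [max_eq_left hle, max_eq_left hle'] at h2
    exact Or.inl ⟨h2, h1⟩

/-- `toPair` is surjective: every adjacency pair comes from an edge. -/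
theorem toPair_surjective {n : ℕ} {E : Type*} [Fintype E] (G : MultiGraph (Fin n) E)
    (hs : G.IsSimple) : Function.Surjective (G.toPair hs) := by
  rintro ⟨⟨i, j⟩, hij, hA⟩
  unfold adjOf at hA
  rw [decide_eq_true_eq] at hA
  obtain ⟨e, he⟩ := hA
  refine ⟨e, Subtype.ext ?_⟩
  simp only [toPair]
  rcases he with ⟨h1, h2⟩ | ⟨h1, h2⟩
  · rw [h1, h2, min_eq_left hij.le, max_eq_right hij.le]
  · rw [h1, h2, min_eq_right hij.le, max_eq_left hij.le]

/-- The edges of a simple graph on `Fin n` are the adjacency pairs of its matrix. -/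
noncomputable def edgeEquiv {n : ℕ} {E : Type*} [Fintype E] (G : MultiGraph (Fin n) E)
    (hs : G.IsSimple) : E ≃ EdgesOf (adjOf G) :=
  Equiv.ofBijective (G.toPair hs) ⟨G.toPair_injective hs, G.toPair_surjective hs⟩

/-- Re-indexed along `edgeEquiv`, a simple graph has the endpoint sets of `graphOf (adjOf G)`. -/
theorem sameEnds_graphOf_adjOf {n : ℕ} {E : Type*} [Fintype E] (G : MultiGraph (Fin n) E)
    (hs : G.IsSimple) : SameEnds (G.mapEdges (G.edgeEquiv hs)) (graphOf (adjOf G)) := by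
  intro ij
  set e := (G.edgeEquiv hs).symm ij with he
  have hij : G.toPair hs e = ij := (G.edgeEquiv hs).apply_symm_apply ij
  have h1 : (graphOf (adjOf G)).fst ij = min (G.fst e) (G.snd e) := by
    rw [← hij]
    rfl
  have h2 : (graphOf (adjOf G)).snd ij = max (G.fst e) (G.snd e) := by
    rw [← hij]
    rfl
  rw [h1, h2]
  show (min _ _ = G.fst e ∧ max _ _ = G.snd e) ∨ (min _ _ = G.snd e ∧ max _ _ = G.fst e)
  rcases le_total (G.fst e) (G.snd e) with hle | hle
  · exact Or.inl ⟨min_eq_left hle, max_eq_right hle⟩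
  · exact Or.inr ⟨min_eq_right hle, max_eq_left hle⟩

/-- **A simple graph on `Fin n` has the class sums of the graph of its adjacency matrix.** -/
theorem cubeSumC011_eq_graphOf_adjOf {n : ℕ} {E : Type*} [Fintype E] [DecidableEq E]
    (G : MultiGraph (Fin n) E) (hs : G.IsSimple) (m : Fin 4 → Fin n) :
    G.cubeSumC011 m = (graphOf (adjOf G)).cubeSumC011 m := by
  rw [← G.cubeSumC011_mapEdges (G.edgeEquiv hs) m]
  exact (cubeSumC011_eq_of_sameEnds (G.sameEnds_graphOf_adjOf hs) m).symm

/-- Pushing a simple graph forward along an injective vertex map keeps it simple. -/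
theorem isSimple_mapVertices {V V' E : Type*} (G : MultiGraph V E) {ι : V → V'}
    (hι : Function.Injective ι) (hs : G.IsSimple) : (G.mapVertices ι).IsSimple := by
  constructor
  · intro e h
    exact hs.1 e (hι h)
  · intro e e' h
    apply hs.2
    rcases h with ⟨h1, h2⟩ | ⟨h1, h2⟩
    · exact Or.inl ⟨hι h1, hι h2⟩
    · exact Or.inr ⟨hι h1, hι h2⟩

end MultiGraph

/-- **The adjacency-matrix census gives the injective simple census on `≤ n` vertices**: if
`0 ≤ CS(graphOf A, m)` for every matrix `A : Fin n → Fin n → Bool` and every injective marking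
`m : Fin 4 → Fin n`, then `LemmaBPlusSimpleInjUpTo n`. -/
theorem LemmaBPlusSimpleInjUpTo_of_graphOf (n : ℕ)
    (h : ∀ (A : Fin n → Fin n → Bool) (m : Fin 4 → Fin n), Function.Injective m →
      0 ≤ (MultiGraph.graphOf A).cubeSumC011 m) : LemmaBPlusSimpleInjUpTo n := by
  intro V E _ _ _ hV G hs m hm
  obtain ⟨ι⟩ : Nonempty (V ↪ Fin n) :=
    Function.Embedding.nonempty_of_card_le (by simpa using hV)
  rw [← G.cubeSumC011_mapVertices ι.injective m,
    (G.mapVertices ι).cubeSumC011_eq_graphOf_adjOf (G.isSimple_mapVertices ι.injective hs)]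
  exact h _ _ (ι.injective.comp hm)

/-- **C-005 on ≤ n vertices from the adjacency-matrix census.** -/
theorem C005UpTo_of_graphOf (n : ℕ)
    (h : ∀ (A : Fin n → Fin n → Bool) (m : Fin 4 → Fin n), Function.Injective m →
      0 ≤ (MultiGraph.graphOf A).cubeSumC011 m) : C005UpTo n :=
  C005UpTo_of_simpleInj (LemmaBPlusSimpleInjUpTo_of_graphOf n h)

/-- **C-011 on ≤ n vertices from the adjacency-matrix census.** -/
theorem C011UpTo_of_graphOf (n : ℕ)
    (h : ∀ (A : Fin n → Fin n → Bool) (m : Fin 4 → Fin n), Function.Injective m →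
      0 ≤ (MultiGraph.graphOf A).cubeSumC011 m) : C011UpTo n :=
  C011UpTo_of_simpleInj (LemmaBPlusSimpleInjUpTo_of_graphOf n h)

end PercRepro
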